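import Literature.AlgebraicGeometry.Resolution.HilbertSamuelLowerBound
import Literature.AlgebraicGeometry.Resolution.RegularLocusDense
import Mathlib.AlgebraicGeometry.Noetherian
import Mathlib.AlgebraicGeometry.Properties
import HarnessLib

/-!
# `ModificationsResolve` (crux stmt-ResolutionOfSingularities-18507), line `Sketch` —
stub `stub_dense_compl_hsMaxLocus` (CJS Rem. 6.13: `Y ∖ Y_max` is dense)

Helper file (`--supports stmt-ResolutionOfSingularities-18507`; does not close the item).

For a reduced, non-regular scheme `Y` locally of finite type over a field `k` with `dim Y ≤ N`,
the complement of the Hilbert–Samuel locus `Y_max = Scheme.hsMaxLocus Y N` (the points where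
`H^N_Y` takes a maximal value, CJS Def. 2.35) is DENSE in `Y`.  Proof (CJS Rem. 6.13 (b)–(c) /
Rem. 2.32): `Y` is locally Noetherian (`LocallyOfFiniteType.isLocallyNoetherian`), every local
ring has dimension `d ≤ N` (`dim 𝒪_{Y,y} ≤ dim Y ≤ N`, Stacks 02IZ), so
`Y_max ⊆ Y ∖ Reg Y` for non-regular `Y` (`Scheme.hsMaxLocus_subset_compl_regularLocus`), i.e.
`Reg Y ⊆ Y ∖ Y_max`; and the regular locus of a reduced scheme is dense
(`Scheme.dense_regularLocus`: it contains every maximal point).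

Source: V. Cossart, U. Jannsen, S. Saito, *Desingularization: Invariants and Strategy*,
LNM 2270 (2020), Rem. 2.32, Def. 2.35, Rem. 6.13. [CossartJannsenSaito2020]
-/

set_option linter.dupNamespace false -- mandated namespace of this single-conjunct summit

noncomputable section

open CategoryTheory AlgebraicGeometry TopologicalSpace
open Literature.AlgebraicGeometry.Resolution

namespace Summit.ResolutionOfSingularities.ResolutionOfSingularities.Theorems.ModificationsResolve.Sketch

/-- **`dim 𝒪_{Y,y} ≤ dim Y`**: `dim 𝒪_{Y,y}` is the coheight of `y` in the specialisation order
(Stacks 02IZ), bounded by the Krull dimension of that order, i.e. (sobriety) of the lattice of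
irreducible closed subsets.  (Local copy of the tree's `ringKrullDim_stalk_le_topologicalKrullDim`,
kept private to avoid its import closure.) [cite: StacksProject, Tag 02IZ] -/
private theorem ringKrullDim_stalk_le_topologicalKrullDim_aux {Y : Scheme.{0}} (y : Y) :
    ringKrullDim (Y.presheaf.stalk y) ≤ topologicalKrullDim Y := by
  rw [AlgebraicGeometry.ringKrullDim_stalk_eq_coheight, topologicalKrullDim,
    Order.krullDim_eq_of_orderIso (irreducibleSetEquivPoints (α := Y))]
  exact Order.coheight_le_krullDim y

/-- On a locally Noetherian scheme of dimension `≤ N` every local ring has a (finite) dimension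
`d ≤ N` — the standing hypothesis "`N ≥ dim X`" of CJS Def. 2.28 in the pointwise form used by
`HilbertSamuelStrata.lean`. [cite: CossartJannsenSaito2020, Def. 2.28] -/
private theorem exists_ringKrullDim_stalk_eq_aux {Y : Scheme.{0}} [IsLocallyNoetherian Y] {N : ℕ}
    (h : topologicalKrullDim Y ≤ (N : WithBot ℕ∞)) (y : Y) :
    ∃ d : ℕ, ringKrullDim (Y.presheaf.stalk y) = d ∧ d ≤ N := by
  obtain ⟨d, hd⟩ : ∃ d : ℕ, ringKrullDim (Y.presheaf.stalk y) = d :=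
    Literature.RingTheory.HilbertSamuel.exists_nat_eq_of_ne_bot_of_ne_top
      ringKrullDim_ne_bot ringKrullDim_ne_top
  refine ⟨d, hd, ?_⟩
  have hle := (ringKrullDim_stalk_le_topologicalKrullDim_aux y).trans h
  rw [hd] at hle
  exact_mod_cast hle

/-- **CJS Rem. 6.13: `Y ∖ Y_max` is dense for a reduced non-regular `Y` of finite type over a
field with `dim Y ≤ N`.**  `Y_max ⊆ Y ∖ Reg Y` (`Scheme.hsMaxLocus_subset_compl_regularLocus`, its
dimension hypothesis from `dim 𝒪_{Y,y} ≤ dim Y ≤ N`), i.e. `Reg Y ⊆ Y ∖ Y_max`, and `Reg Y` is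
dense on a reduced scheme (`Scheme.dense_regularLocus`); `IsLocallyNoetherian Y` from
`LocallyOfFiniteType.isLocallyNoetherian`. [cite: CossartJannsenSaito2020, Rem. 6.13] -/
theorem stub_dense_compl_hsMaxLocus {k : Type} [Field k] {Y : Scheme.{0}}
    (g : Y ⟶ Spec (.of k)) [LocallyOfFiniteType g] [IsReduced Y] (hY : ¬ Scheme.IsRegular Y)
    {N : ℕ} (hdim : topologicalKrullDim Y ≤ (N : WithBot ℕ∞)) :
    Dense (Scheme.hsMaxLocus Y N)ᶜ := by
  haveI : IsLocallyNoetherian Y := LocallyOfFiniteType.isLocallyNoetherian g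
  have hsub : Scheme.hsMaxLocus Y N ⊆ (Scheme.regularLocus Y)ᶜ :=
    Scheme.hsMaxLocus_subset_compl_regularLocus (exists_ringKrullDim_stalk_eq_aux hdim) hY
  exact (Scheme.dense_regularLocus Y).mono (Set.subset_compl_comm.mp hsub)

end Summit.ResolutionOfSingularities.ResolutionOfSingularities.Theorems.ModificationsResolve.Sketch

end
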